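import Summits.Schanuel.Schanuel.Theses.RoyCriterion
import Summits.Schanuel.Schanuel.Theorems.RoyCriterionSchanuelTwoStubNesterenkoPlanes
import Summits.Schanuel.Schanuel.Theorems.RoyCriterionSchanuelTwoLineSketch

/-!
# `SchanuelTwo` — the special-line trichotomy (typed decomposition of crux stmt-Schanuel-0069)

Crux `Summit.Schanuel.Schanuel.Theses.RoyCriterion.SchanuelTwo`
(`∀ x : Fin 2 → ℂ, LinearIndependent ℚ x → 2 ≤ trdeg_ℚ ℚ(x, e^x)`; Schanuel's conjecture, `n = 2`).

`trdeg_ℚ ℚ(x, e^x)` is an invariant of the `ℚ`-plane `V = span_ℚ(x)` (landed: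
`Summit.Schanuel.Schanuel.Theorems.trdeg_SF_eq_of_span_eq`). A `ℚ`-line `ℚv ⊂ V` (`v ≠ 0`) is
*special* if `v ∈ ℚ̄` (an **E-line**: `e^v` is then a value of the E-function `e^z` at an algebraic
point) or `e^v ∈ ℚ̄` (an **L-line**: `v` is then a logarithm of an algebraic number, a 1-period).
By Hermite–Lindemann no line is both. Every plane falls in exactly one of three classes, and the
crux splits accordingly into three statements, none of which is the crux and whose conjunction is:

* **E** (`SchanuelTwoAlgPoint`): planes through a non-zero algebraic point `β`:
  `∀ β t, β ∈ ℚ̄ → (β, t) ℚ-free → 2 ≤ trdeg ℚ(β, t, e^β, e^t)`. Contains Lindemann–Weierstrass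
  (`t ∈ ℚ̄`, PROVED) and the open instances `e ⊥ π` (`t = iπ`), `e ⊥ log 2`, `e ⊥ e^e` (`t = e`).
* **L** (`SchanuelTwoLogPoint`): planes with no algebraic point but through a logarithm `l` of an
  algebraic number: contains the two-logarithms conjecture (`t = log 3`, `l = log 2`), `π ⊥ log 2`
  (`l = iπ`, `t = log 2`), Gel'fond's `log 2 ⊥ 2^{√2}` (`t = √2·l`), `e^{π²} ∉ ℚ̄` (`l = iπ`, `t = π²`);
  PROVED members: every such plane through `π` or `π√3` (Nesterenko), the B–W flagship
  `(iπ, −π²/log 2)` (p98157).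
* **D** (`SchanuelTwoNoSpecialLine`): planes with no special line at all (all of `x₁, x₂` and every
  `e^v`, `v ∈ V ∖ 0`, transcendental): the generic ("dark") planes.

This file proves, sorry-free and definition-free (statements spelled out so that the route items
created by `route edit --split` match them by `δ`-unfolding):
* `schanuelTwoSplit_exists_basis` — a non-zero vector of a `ℚ`-plane extends to a basis of it;
* `schanuelTwo_of_subs : E → L → D → SchanuelTwo` — the glue (case split on the special lines of
  `span_ℚ(x)`, basis extension, plane invariance);
* `schanuelTwoAlgPoint_of_schanuelTwo`, `schanuelTwoLogPoint_of_schanuelTwo`,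
  `schanuelTwoNoSpecialLine_of_schanuelTwo` — each piece is a restriction of the crux (so none is
  stronger than it);
* `expOnePi_of_schanuelTwoAlgPoint` — the E-piece alone already carries `e ⊥ π`;
* `schanuelTwoSplit_noAlgPoint_piI_logTwo`, `piLogTwo_of_schanuelTwoLogPoint` — `(πi, log 2)` is an
  L-plane with no algebraic point, and the L-piece alone already carries `π ⊥ log 2`.

No definitions, no sorry; axioms `propext`, `Classical.choice`, `Quot.sound`.

## References
* [Lang1966] S. Lang, *Introduction to transcendental numbers*, Addison-Wesley 1966, pp. 30–31.
* [Waldschmidt2000] M. Waldschmidt, *Diophantine approximation on linear algebraic groups*,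
  Grundlehren 326, Springer 2000, §1.4 (the four open pairs) and Conjecture 1.15 (logarithms).
-/

set_option linter.dupNamespace false

noncomputable section

open Complex IntermediateField

namespace Summit.Schanuel.Schanuel.Theorems

/-! ### Linear algebra of the `ℚ`-plane -/

/-- **Basis extension in a `ℚ`-plane.** If `x : Fin 2 → ℂ` is `ℚ`-linearly independent and
`v ∈ span_ℚ(x)` is non-zero, then `v` is the first vector of a basis `(v, w)` of the same plane
(with `w = x 0` or `w = x 1`). [folklore] -/
theorem schanuelTwoSplit_exists_basis (x : Fin 2 → ℂ) (hx : LinearIndependent ℚ x) {v : ℂ}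
    (hv : v ∈ Submodule.span ℚ (Set.range x)) (hv0 : v ≠ 0) :
    ∃ w : ℂ, LinearIndependent ℚ ![v, w] ∧
      Submodule.span ℚ (Set.range ![v, w]) = Submodule.span ℚ (Set.range x) := by
  obtain ⟨c, hc⟩ := (Submodule.mem_span_range_iff_exists_fun ℚ).mp hv
  rw [Fin.sum_univ_two] at hc
  -- the independence of `x` in pair form
  have hx2 : ∀ s t : ℚ, s • x 0 + t • x 1 = 0 → s = 0 ∧ t = 0 := by
    intro s t hst
    have h := Fintype.linearIndependent_iff.mp hx ![s, t] (by simpa [Fin.sum_univ_two] using hst)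
    exact ⟨by simpa using h 0, by simpa using h 1⟩
  have hx0mem : x 0 ∈ Submodule.span ℚ (Set.range x) := Submodule.subset_span ⟨0, rfl⟩
  have hx1mem : x 1 ∈ Submodule.span ℚ (Set.range x) := Submodule.subset_span ⟨1, rfl⟩
  -- a generic tool: the span of a pair is contained in any submodule containing both
  have pair_le : ∀ (a b : ℂ) (S : Submodule ℚ ℂ), a ∈ S → b ∈ S →
      Submodule.span ℚ (Set.range ![a, b]) ≤ S := by
    intro a b S ha hb
    rw [Submodule.span_le]
    rintro _ ⟨i, rfl⟩
    fin_cases i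
    · simpa using ha
    · simpa using hb
  have x_le : ∀ (a b : ℂ), x 0 ∈ Submodule.span ℚ (Set.range ![a, b]) →
      x 1 ∈ Submodule.span ℚ (Set.range ![a, b]) →
      Submodule.span ℚ (Set.range x) ≤ Submodule.span ℚ (Set.range ![a, b]) := by
    intro a b h0 h1
    rw [Submodule.span_le]
    rintro _ ⟨i, rfl⟩
    fin_cases i
    · simpa using h0
    · simpa using h1
  by_cases hc0 : c 0 = 0
  · -- `v = c 1 • x 1` with `c 1 ≠ 0`; take `w = x 0`
    have hv' : v = c 1 • x 1 := by rw [← hc, hc0, zero_smul, zero_add]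
    have hc1 : c 1 ≠ 0 := by
      rintro h1
      exact hv0 (by rw [hv', h1, zero_smul])
    refine ⟨x 0, ?_, le_antisymm (pair_le _ _ _ hv hx0mem) (x_le _ _ ?_ ?_)⟩
    · rw [LinearIndependent.pair_iff]
      intro s t hst
      rw [hv', smul_smul, add_comm] at hst
      obtain ⟨ht, hs⟩ := hx2 t (s * c 1) hst
      rcases mul_eq_zero.mp hs with h | h
      · exact ⟨h, ht⟩
      · exact absurd h hc1
    · exact Submodule.subset_span ⟨1, rfl⟩
    · have h : x 1 = (c 1)⁻¹ • v := by rw [hv', smul_smul, inv_mul_cancel₀ hc1, one_smul]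
      rw [h]
      exact Submodule.smul_mem _ _ (Submodule.subset_span ⟨0, rfl⟩)
  · -- `c 0 ≠ 0`; take `w = x 1`
    refine ⟨x 1, ?_, le_antisymm (pair_le _ _ _ hv hx1mem) (x_le _ _ ?_ ?_)⟩
    · rw [LinearIndependent.pair_iff]
      intro s t hst
      rw [← hc, smul_add, smul_smul, smul_smul, add_assoc, ← add_smul] at hst
      obtain ⟨hs, hst'⟩ := hx2 (s * c 0) (s * c 1 + t) hst
      have hs0 : s = 0 := by
        rcases mul_eq_zero.mp hs with h | h
        · exact h
        · exact absurd h hc0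
      refine ⟨hs0, ?_⟩
      rw [hs0, zero_mul, zero_add] at hst'
      exact hst'
    · have h : x 0 = (c 0)⁻¹ • (v - c 1 • x 1) := by
        rw [← hc, add_sub_cancel_right, smul_smul, inv_mul_cancel₀ hc0, one_smul]
      rw [h]
      exact Submodule.smul_mem _ _ (Submodule.sub_mem _ (Submodule.subset_span ⟨0, rfl⟩)
        (Submodule.smul_mem _ _ (Submodule.subset_span ⟨1, rfl⟩)))
    · exact Submodule.subset_span ⟨1, rfl⟩

/-! ### The glue: E, L, D ⟹ the crux -/

/-- **Special-line trichotomy** (glue of the typed split of `SchanuelTwo`): if Schanuel `n = 2`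
holds (E) on every plane through a non-zero algebraic point, (L) on every plane without algebraic
points but through a logarithm of an algebraic number, and (D) on every plane with neither, then
it holds — the three classes exhaust the `ℚ`-planes, and `trdeg ℚ(x, e^x)` depends only on the
plane (`trdeg_SF_eq_of_span_eq`), so in cases E and L one may pass to a basis starting with the
special vector (`schanuelTwoSplit_exists_basis`). [folklore] -/
theorem schanuelTwo_of_subs
    (hE : ∀ (β t : ℂ), IsAlgebraic ℚ β → LinearIndependent ℚ ![β, t] →
      (2 : Cardinal) ≤ Algebra.trdeg ℚ
        ↥(IntermediateField.adjoin ℚ (Set.range ![β, t] ∪ Set.range (Complex.exp ∘ ![β, t]))))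
    (hL : ∀ (l t : ℂ), IsAlgebraic ℚ (Complex.exp l) → LinearIndependent ℚ ![l, t] →
      (∀ v ∈ Submodule.span ℚ (Set.range ![l, t]), IsAlgebraic ℚ v → v = 0) →
      (2 : Cardinal) ≤ Algebra.trdeg ℚ
        ↥(IntermediateField.adjoin ℚ (Set.range ![l, t] ∪ Set.range (Complex.exp ∘ ![l, t]))))
    (hD : ∀ (x : Fin 2 → ℂ), LinearIndependent ℚ x →
      (∀ v ∈ Submodule.span ℚ (Set.range x), IsAlgebraic ℚ v → v = 0) →
      (∀ v ∈ Submodule.span ℚ (Set.range x), IsAlgebraic ℚ (Complex.exp v) → v = 0) →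
      (2 : Cardinal) ≤ Algebra.trdeg ℚ
        ↥(IntermediateField.adjoin ℚ (Set.range x ∪ Set.range (Complex.exp ∘ x)))) :
    Summit.Schanuel.Schanuel.Theses.RoyCriterion.SchanuelTwo := by
  intro x hx
  by_cases hA : ∃ v ∈ Submodule.span ℚ (Set.range x), v ≠ 0 ∧ IsAlgebraic ℚ v
  · -- case E: an algebraic point on the plane
    obtain ⟨v, hv, hv0, halg⟩ := hA
    obtain ⟨w, hli, hspan⟩ := schanuelTwoSplit_exists_basis x hx hv hv0
    rw [← trdeg_SF_eq_of_span_eq hspan]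
    exact hE v w halg hli
  · push Not at hA
    have hA' : ∀ v ∈ Submodule.span ℚ (Set.range x), IsAlgebraic ℚ v → v = 0 := by
      intro v hv halg
      by_contra hne
      exact hA v hv hne halg
    by_cases hB : ∃ v ∈ Submodule.span ℚ (Set.range x), v ≠ 0 ∧ IsAlgebraic ℚ (cexp v)
    · -- case L: no algebraic point, but a logarithm of an algebraic number on the plane
      obtain ⟨l, hl, hl0, halg⟩ := hB
      obtain ⟨w, hli, hspan⟩ := schanuelTwoSplit_exists_basis x hx hl hl0
      rw [← trdeg_SF_eq_of_span_eq hspan]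
      refine hL l w halg hli ?_
      intro v hv hva
      rw [hspan] at hv
      exact hA' v hv hva
    · -- case D: no special line
      push Not at hB
      have hB' : ∀ v ∈ Submodule.span ℚ (Set.range x), IsAlgebraic ℚ (cexp v) → v = 0 := by
        intro v hv halg
        by_contra hne
        exact hB v hv hne halg
      exact hD x hx hA' hB'

/-! ### Each piece is a restriction of the crux -/

/-- The E-piece follows from the crux (it is a restriction of it). [folklore] -/
theorem schanuelTwoAlgPoint_of_schanuelTwo
    (hS : Summit.Schanuel.Schanuel.Theses.RoyCriterion.SchanuelTwo) :
    ∀ (β t : ℂ), IsAlgebraic ℚ β → LinearIndependent ℚ ![β, t] →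
      (2 : Cardinal) ≤ Algebra.trdeg ℚ
        ↥(IntermediateField.adjoin ℚ (Set.range ![β, t] ∪ Set.range (Complex.exp ∘ ![β, t]))) :=
  fun _ _ _ hli => hS _ hli

/-- The L-piece follows from the crux. [folklore] -/
theorem schanuelTwoLogPoint_of_schanuelTwo
    (hS : Summit.Schanuel.Schanuel.Theses.RoyCriterion.SchanuelTwo) :
    ∀ (l t : ℂ), IsAlgebraic ℚ (Complex.exp l) → LinearIndependent ℚ ![l, t] →
      (∀ v ∈ Submodule.span ℚ (Set.range ![l, t]), IsAlgebraic ℚ v → v = 0) →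
      (2 : Cardinal) ≤ Algebra.trdeg ℚ
        ↥(IntermediateField.adjoin ℚ (Set.range ![l, t] ∪ Set.range (Complex.exp ∘ ![l, t]))) :=
  fun _ _ _ hli _ => hS _ hli

/-- The D-piece follows from the crux. [folklore] -/
theorem schanuelTwoNoSpecialLine_of_schanuelTwo
    (hS : Summit.Schanuel.Schanuel.Theses.RoyCriterion.SchanuelTwo) :
    ∀ (x : Fin 2 → ℂ), LinearIndependent ℚ x →
      (∀ v ∈ Submodule.span ℚ (Set.range x), IsAlgebraic ℚ v → v = 0) →
      (∀ v ∈ Submodule.span ℚ (Set.range x), IsAlgebraic ℚ (Complex.exp v) → v = 0) →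
      (2 : Cardinal) ≤ Algebra.trdeg ℚ
        ↥(IntermediateField.adjoin ℚ (Set.range x ∪ Set.range (Complex.exp ∘ x))) :=
  fun x hx _ _ => hS x hx

/-! ### The E-piece already carries the flagship open instance -/

/-- **The E-piece implies the algebraic independence of `e` and `π`** (`β = 1`, `t = πi`): so the
E-piece is an OPEN statement (Lang 1966; Waldschmidt 2000 §1.4), not a lemma. [folklore] -/
theorem expOnePi_of_schanuelTwoAlgPoint
    (hE : ∀ (β t : ℂ), IsAlgebraic ℚ β → LinearIndependent ℚ ![β, t] →
      (2 : Cardinal) ≤ Algebra.trdeg ℚ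
        ↥(IntermediateField.adjoin ℚ (Set.range ![β, t] ∪ Set.range (Complex.exp ∘ ![β, t])))) :
    Literature.NumberTheory.Transcendental.ExpOnePiAlgebraicIndependent :=
  expOnePiAlgebraicIndependent_of_two_le_trdeg
    (hE 1 ((Real.pi : ℂ) * I) (isAlgebraic_one (R := ℚ) (A := ℂ))
      Literature.Barriers.Schanuel.linearIndependent_one_piI)


/-! ### The L-piece carries `π ⊥ log 2` (and the two-logarithms conjecture) -/

/-- `log 2` is transcendental (Hermite–Lindemann: `e^{log 2} = 2`). [cite: BakerTNT1975, Ch. 1 Theorem 1.4] -/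
theorem schanuelTwoSplit_transcendental_logTwo : Transcendental ℚ (Real.log 2 : ℂ) := by
  intro halg
  have hne : (Real.log 2 : ℂ) ≠ 0 := by exact_mod_cast (Real.log_pos one_lt_two).ne'
  refine Literature.NumberTheory.Transcendental.transcendental_exp_holds halg hne ?_
  rw [← Complex.ofReal_exp, Real.exp_log two_pos]
  exact_mod_cast isAlgebraic_nat (R := ℚ) (A := ℂ) 2

/-- Complex conjugation preserves algebraicity over `ℚ`. [folklore] -/
theorem schanuelTwoSplit_isAlgebraic_conj {v : ℂ} (halg : IsAlgebraic ℚ v) :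
    IsAlgebraic ℚ (starRingEnd ℂ v) := by
  obtain ⟨p, hp0, hpv⟩ := halg
  refine ⟨p, hp0, ?_⟩
  have hcomp : (starRingEnd ℂ).comp (algebraMap ℚ ℂ) = algebraMap ℚ ℂ :=
    RingHom.ext fun q => by simp
  rw [Polynomial.aeval_def, ← hcomp, ← Polynomial.hom_eval₂, ← Polynomial.aeval_def, hpv, map_zero]

/-- **The plane `span_ℚ(πi, log 2)` has no algebraic point**: for `v = c₀ πi + c₁ log 2 ∈ ℚ̄`,
`v + v̄ = 2c₁ log 2` and `v − v̄ = 2c₀ πi` are algebraic, so `c₁ = 0` (`log 2 ∉ ℚ̄`) and `c₀ = 0`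
(`π ∉ ℚ̄`). Hence `(πi, log 2)` is an L-plane that is NOT an E-plane. [folklore] -/
theorem schanuelTwoSplit_noAlgPoint_piI_logTwo :
    ∀ v ∈ Submodule.span ℚ (Set.range ![(Real.pi : ℂ) * I, (Real.log 2 : ℂ)]),
      IsAlgebraic ℚ v → v = 0 := by
  intro v hv halg
  obtain ⟨c, hc⟩ := (Submodule.mem_span_range_iff_exists_fun ℚ).mp hv
  rw [Fin.sum_univ_two] at hc
  simp only [Matrix.cons_val_zero, Matrix.cons_val_one, Matrix.cons_val_fin_one,
    Rat.smul_def] at hc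
  -- hc : ↑(c 0) * (↑π * I) + ↑(c 1) * ↑(log 2) = v
  have hconj := schanuelTwoSplit_isAlgebraic_conj halg
  have hsum : v + starRingEnd ℂ v = (2 * c 1 : ℚ) * (Real.log 2 : ℂ) := by
    rw [← hc]
    simp only [map_add, map_mul, map_ratCast, Complex.conj_ofReal, Complex.conj_I]
    push_cast
    ring
  have hdiff : v - starRingEnd ℂ v = (2 * c 0 : ℚ) * ((Real.pi : ℂ) * I) := by
    rw [← hc]
    simp only [map_add, map_mul, map_ratCast, Complex.conj_ofReal, Complex.conj_I]
    push_cast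
    ring
  have hc1 : c 1 = 0 := by
    by_contra h1
    have hq : (2 * c 1 : ℚ) ≠ 0 := mul_ne_zero two_ne_zero h1
    apply schanuelTwoSplit_transcendental_logTwo
    have key : (Real.log 2 : ℂ) = ((2 * c 1)⁻¹ : ℚ) * (v + starRingEnd ℂ v) := by
      rw [hsum, ← mul_assoc, ← Rat.cast_mul, inv_mul_cancel₀ hq, Rat.cast_one, one_mul]
    rw [key]
    exact (isAlgebraic_algebraMap (R := ℚ) (A := ℂ) ((2 * c 1)⁻¹ : ℚ)).mul (halg.add hconj)
  have hc0 : c 0 = 0 := by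
    by_contra h0
    have hq : (2 * c 0 : ℚ) ≠ 0 := mul_ne_zero two_ne_zero h0
    apply transcendental_piI
    have key : (Real.pi : ℂ) * I = ((2 * c 0)⁻¹ : ℚ) * (v - starRingEnd ℂ v) := by
      rw [hdiff, ← mul_assoc, ← Rat.cast_mul, inv_mul_cancel₀ hq, Rat.cast_one, one_mul]
    rw [key]
    exact (isAlgebraic_algebraMap (R := ℚ) (A := ℂ) ((2 * c 0)⁻¹ : ℚ)).mul (halg.sub hconj)
  rw [← hc, hc0, hc1]
  push_cast
  ring

/-- **The L-piece implies the algebraic independence of `π` and `log 2`** (`l = πi`, `e^l = −1`;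
`t = log 2`; the plane has no algebraic point): an OPEN statement ("not even one pair of
algebraically independent logarithms of algebraic numbers is known", Roy 1992; Baker gives only
`ℚ̄`-linear independence). So the L-piece is not a lemma either. [cite: Roy1992, Introduction p. 22] -/
theorem piLogTwo_of_schanuelTwoLogPoint
    (hL : ∀ (l t : ℂ), IsAlgebraic ℚ (Complex.exp l) → LinearIndependent ℚ ![l, t] →
      (∀ v ∈ Submodule.span ℚ (Set.range ![l, t]), IsAlgebraic ℚ v → v = 0) →
      (2 : Cardinal) ≤ Algebra.trdeg ℚ
        ↥(IntermediateField.adjoin ℚ (Set.range ![l, t] ∪ Set.range (Complex.exp ∘ ![l, t])))) :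
    AlgebraicIndependent ℚ ![(Real.pi : ℂ) * I, (Real.log 2 : ℂ)] := by
  have hexp : IsAlgebraic ℚ (cexp ((Real.pi : ℂ) * I)) := by
    rw [Complex.exp_pi_mul_I]
    simpa using isAlgebraic_algebraMap (R := ℚ) (A := ℂ) (-1)
  have h2 := hL _ _ hexp Literature.Barriers.Schanuel.linearIndependent_piI_log_two
    schanuelTwoSplit_noAlgPoint_piI_logTwo
  have hT : ∀ z ∈ Set.range (Complex.exp ∘ ![(Real.pi : ℂ) * I, (Real.log 2 : ℂ)]),
      IsAlgebraic ℚ z := by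
    rintro _ ⟨i, rfl⟩
    fin_cases i
    · simpa using hexp
    · simp only [Fin.mk_one, Fin.isValue, Function.comp_apply, Matrix.cons_val_one,
        Matrix.cons_val_fin_one]
      rw [← Complex.ofReal_exp, Real.exp_log two_pos]
      simpa using isAlgebraic_algebraMap (R := ℚ) (A := ℂ) 2
  have h2' : ((2 : ℕ) : Cardinal) ≤ Algebra.trdeg ℚ
      (adjoin ℚ (Set.range ![(Real.pi : ℂ) * I, (Real.log 2 : ℂ)])) := by
    have h := h2.trans_eq
      (Literature.Barriers.Schanuel.trdeg_adjoin_union_eq_of_isAlgebraic _ _ hT)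
    exact_mod_cast h
  exact Literature.Barriers.Schanuel.algebraicIndependent_of_le_trdeg_adjoin _ h2'

end Summit.Schanuel.Schanuel.Theorems

end
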